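import Literature.NumberTheory.EllipticCurves.ComplexMultiplicationCoatesWilesReductionIndexProofs
import Literature.NumberTheory.EllipticCurves.MazurTorsionStepOneAtNProofs
import Literature.NumberTheory.EllipticCurves.PAdicGrossZagierConstantTermProofs
import HarnessLib

/-!
# BirchSwinnertonDyer / LeadingTerm — crux `TamePinchR` (stmt-BirchSwinnertonDyer-17007),
# line `Sketch`, stub **C** `stub_localTorsionTrivial`

Registered stub **C** of the skeleton `Cruxes/TamePinchR/Lines/Sketch.lean` (C.-H. Kim's
hypothesis (iii), arXiv:2203.12159 Thm. 1.11): for a globally minimal elliptic `W/ℚ` and a prime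
`p ≥ 5` of good reduction with `a_p ≢ 1 (mod p)`, the group `E(ℚ_p)` has no point of order `p`.

Proof (Silverman, *AEC* VII.3.1 / VII.2.1, assembled from tree theorems, "index route"):

* good reduction at `p` of the globally minimal `W` means `p ∤ Δ_min(W)` (tree
  `WeierstrassCurve.not_dvd_minimalDiscriminantInt_of_hasGoodReductionAtPrime`: `W ⊗ ℚ_p` is
  itself a `ℤ_p`-minimal equation, AEC VII.1.3(b), VII.5.1(a));
* hence `N_p • Q ∈ E₁(ℚ_p)` for every `Q ∈ E(ℚ_p)`, `N_p = #Ẽ(𝔽_p) = reductionPointCount W p`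
  (tree `isInReductionKernel_reductionPointCount_nsmul`, the reduction homomorphism of AEC VII.2.1);
* `E₁(ℚ_p)[p] = 0` for `p ≥ 3` (tree `not_prime_zsmul_eq_zero_of_one_lt_norm`, AEC VII.3.1 via
  division polynomials), so `p • P = 0` forces `N_p • P = 0`;
* `a_p = p + 1 - N_p ≢ 1 (mod p)` says `p ∤ N_p`, so `addOrderOf P ∣ gcd(p, N_p) = 1`, `P = 0`.
-/

set_option linter.dupNamespace false

noncomputable section

namespace Summit.BirchSwinnertonDyer.BirchSwinnertonDyer.Theorems

open scoped Classical
open Literature.NumberTheory.EllipticCurves WeierstrassCurve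

variable {p : ℕ} [Fact p.Prime]

/-- **`E₁(ℚ_p)[p] = 0`** (Silverman, *AEC* VII.3 Prop. 3.1 with IV.6 Thm. 6.1, `K = ℚ_p`,
`p ≥ 3`): a `ℚ_p`-point of a `p`-integral equation lying in the kernel of reduction
(`IsInReductionKernel`: `O`, or `‖x‖_p > 1`) and killed by `p` is `O`. Stated for any equation
`V` over `ℚ_p` equal to the base change of a `ℤ_p`-model `W₀`, so that it applies to
`W ⊗ ℚ_p` through `padicModel_baseChange`; the work is the tree's
`not_prime_zsmul_eq_zero_of_one_lt_norm` (division polynomials).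
[cite: SilvermanAEC2009, VII.3 Prop. 3.1] -/
theorem stubC_eq_zero_of_isInReductionKernel (hp3 : 3 ≤ p) (W₀ : WeierstrassCurve ℤ_[p])
    (V : WeierstrassCurve ℚ_[p]) (hV : W₀.baseChange ℚ_[p] = V) [V.IsElliptic]
    (Q : V.toAffine.Point) (hQ : V.IsInReductionKernel Q) (hpQ : (p : ℤ) • Q = 0) : Q = 0 := by
  subst hV
  rcases Q with _ | ⟨x, y, h⟩
  · rfl
  · exact absurd hpQ
      (not_prime_zsmul_eq_zero_of_one_lt_norm hp3 W₀ h ((isInReductionKernel_some _ h).1 hQ))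

omit [Fact p.Prime] in
/-- In an additive group, an element killed by a prime `p` and by a natural number `n` with
`p ∤ n` is zero (`addOrderOf x ∣ gcd(p, n) = 1`). [folklore] -/
theorem stubC_eq_zero_of_zsmul_of_nsmul {A : Type*} [AddGroup A] (hp : p.Prime) {n : ℕ}
    (hn : ¬ p ∣ n) (x : A) (hpx : (p : ℤ) • x = 0) (hnx : n • x = 0) : x = 0 := by
  have h1 : addOrderOf x ∣ p := by
    rw [natCast_zsmul] at hpx
    exact addOrderOf_dvd_iff_nsmul_eq_zero.mpr hpx
  have h2 : addOrderOf x ∣ n := addOrderOf_dvd_iff_nsmul_eq_zero.mpr hnx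
  have hgcd : Nat.gcd p n = 1 := (hp.coprime_iff_not_dvd.mpr hn).gcd_eq_one
  have h3 : addOrderOf x ∣ 1 := hgcd ▸ Nat.dvd_gcd h1 h2
  exact AddMonoid.addOrderOf_eq_one_iff.mp (Nat.dvd_one.mp h3)

omit [Fact p.Prime] in
/-- `a_p ≢ 1 (mod p)` means `p ∤ N_p`: `a_p - 1 = p - N_p` with `N_p = reductionPointCount W p`.
[folklore] -/
theorem stubC_not_dvd_reductionPointCount (W : WeierstrassCurve ℚ) [W.IsGloballyMinimal]
    (hna : ¬ (p : ℤ) ∣ W.frobeniusTrace p - 1) : ¬ p ∣ reductionPointCount W p := by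
  intro h
  apply hna
  rw [frobeniusTrace]
  have e : (p : ℤ) + 1 - (reductionPointCount W p : ℤ) - 1 = (p : ℤ) - reductionPointCount W p := by
    ring
  rw [e]
  exact dvd_sub dvd_rfl (Int.natCast_dvd_natCast.2 h)

/-- Stub **C** (Kim's hypothesis (iii) at a non-anomalous good prime). For a globally minimal
elliptic `W/ℚ` and a prime `p ≥ 5` of good reduction with `a_p ≢ 1 (mod p)`, `E(ℚ_p)` has no point
of order `p`: with `N_p = #Ẽ(𝔽_p) = p + 1 - a_p`, the multiple `N_p • P` lies in the kernel of
reduction `E₁(ℚ_p)` (AEC VII.2.1; tree `isInReductionKernel_reductionPointCount_nsmul`, available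
since good reduction of the globally minimal `W` means `p ∤ Δ_min`), which has no `p`-torsion
(AEC VII.3.1; tree `not_prime_zsmul_eq_zero_of_one_lt_norm`), so `p • P = 0` gives `N_p • P = 0`,
and `p ∤ N_p` forces `P = 0`. [cite: SilvermanAEC2009, VII.3 Prop. 3.1] -/
theorem stub_localTorsionTrivial :
    ∀ (W : WeierstrassCurve ℚ) [W.IsElliptic] [W.IsGloballyMinimal] (p : ℕ) [Fact p.Prime],
      5 ≤ p → W.HasGoodReductionAtPrime p → ¬ (p : ℤ) ∣ W.frobeniusTrace p - 1 →
        ∀ P : (W.baseChange ℚ_[p]).toAffine.Point, (p : ℤ) • P = 0 → P = 0 := by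
  intro W _ _ p _ h5 hgood hna P hpP
  have hΔ : ¬ (p : ℤ) ∣ minimalDiscriminantInt W :=
    W.not_dvd_minimalDiscriminantInt_of_hasGoodReductionAtPrime p hgood
  have hn : ¬ p ∣ reductionPointCount W p := stubC_not_dvd_reductionPointCount W hna
  -- `N_p • P ∈ E₁(ℚ_p)` and `p • (N_p • P) = 0`, so `N_p • P = 0`
  have hker : (W.baseChange ℚ_[p]).IsInReductionKernel (reductionPointCount W p • P) :=
    isInReductionKernel_reductionPointCount_nsmul W p hΔ P
  have hkill : (p : ℤ) • (reductionPointCount W p • P) = 0 := by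
    rw [← natCast_zsmul, ← mul_zsmul, mul_comm, mul_zsmul, hpP, zsmul_zero]
  haveI : (W.baseChange ℚ_[p]).IsElliptic := by rw [baseChange]; infer_instance
  have hnP : reductionPointCount W p • P = 0 :=
    stubC_eq_zero_of_isInReductionKernel (by omega)
      ((integralModelInt W).map (Int.castRingHom ℤ_[p])) (W.baseChange ℚ_[p])
      (padicModel_baseChange W p) _ hker hkill
  exact stubC_eq_zero_of_zsmul_of_nsmul Fact.out hn P hpP hnP

end Summit.BirchSwinnertonDyer.BirchSwinnertonDyer.Theorems

end
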